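import Literature.AlgebraicGeometry.Motives.HodgeTensorFactsHolds
import Literature.AlgebraicGeometry.HodgeTheory.HodgeStructureOfHodgeModel
import Literature.AlgebraicGeometry.HodgeTheory.ComplexConjugationHolds
import Literature.AlgebraicGeometry.Motives.AbelianVariety
import Literature.AlgebraicGeometry.Motives.AbelianVarietyExistence
import Literature.AlgebraicGeometry.Motives.AbelianVarietyProjectiveChart
import HarnessLib

/-!
# Hodge structures of abelian type (André's `ℳ(Ab)` on the Hodge side)

Family `hodge`, layer `Literature/AlgebraicGeometry/Motives`. DEFINITIONS (T0, statement level)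
plus their unfolding lemmas and the PROVED non-vacuity / closure theorems listed under "What is
proved" below; nothing unproved is asserted.

Sources read verbatim. Y. André, *Pour une théorie inconditionnelle des motifs*, Publ. Math. IHÉS 83
(1996) [Andre1996Motifs] (held text `paper:doi-10-1007-bf02698643`), §6.1 (p. 30): "nous étudions les
motifs engendrés par la famille 𝒜b des variétés abéliennes … la sous-catégorie tannakienne `ℳ(𝒜b)_𝒱`
de `ℳ_𝒱` engendrée par les `h(A)` et les motifs d'Artin; elle contient les objets de Tate"; §6.3
(p. 31): "il en résulte que le foncteur « réalisation de Betti-Hodge » de `ℳ(𝒜b)_𝒱` vers la catégorie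
des `ℚ`-structures de Hodge est pleinement fidèle"; Thm. 0.6.3 (p. 9): "Le motif de toute surface K3
projective et de toute hypersurface cubique de `Pⁿ`, `n ≤ 6`, est isomorphe à un motif découpé sur une
variété abélienne." B. Moonen, *Families of motives and the Mumford–Tate conjecture*, Milan J. Math. 85
(2017) [Moonen2017FamiliesMotives], §2–3 (motives of abelian type: the Tannakian subcategory generated
by the `H¹` of abelian varieties, equivalently the objects cut out on `h¹(A)^{⊗ m}(c)`).
P. Deligne, *Théorie de Hodge II* [DeligneHodgeII1971], 2.1.13–2.1.14 (Tate twists), 1.1.12 (tensor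
products of Hodge structures).

## What is defined

For a `ℚ`-Hodge structure `H` of weight `w` on `V` (`Motives.HodgeStructure V w`):

* `HodgeStructure.abelianTensor A hA M hM m c` — the `ℚ`-Hodge structure `(H¹(A(ℂ); ℚ)^{⊗ m})(c)` of
  weight `m - 2c`, where `H¹(A(ℂ); ℚ)` carries the weight-one Hodge structure of the complex abelian
  variety `A` read through a Hodge symmetric Hodge model `M` of `A` (`HodgeModel.hodgeStructure`, file
  `HodgeTheory/HodgeStructureOfHodgeModel`; such models exist, `exists_isReal_hodgeModel_holds`, and the
  structure does not depend on the model, `hodgePQ_independent_of_hodgeModel_holds`), tensor power and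
  Tate twist from `Motives/HodgeTensor` (Deligne's filtration facts supplied by the tree's theorem
  `hodgeTensorFacts_holds`).
* `HodgeStructure.IsOfAbelianType H` — `H` is a DIRECT SUMMAND, in the category of `ℚ`-Hodge
  structures, of some `abelianTensor A hA M hM m c` with `m - 2c = w`: morphisms of Hodge structures
  `j : H → T`, `r : T → H` with `r ∘ j = id`.
* `HodgeStructure.IsAbelianTypeSummand H N` — the `ℚ`-subspace `N ≤ V` is an abelian-type summand
  THROUGH `H`: morphisms `j : H → T`, `r : T → H` with `r (j v) = v` on `N` and `range r ≤ N` (then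
  `N = range r`, `IsAbelianTypeSummand.eq_range`; for `N = ⊤` this is `IsOfAbelianType`,
  `isAbelianTypeSummand_top_iff`).
* `Motives.ratPoints S` — the rational points `{a ∈ Hᵏ(Y; ℚ) | a ⊗ 1 ∈ S}` of a complex subspace
  `S ≤ Hᵏ(Y; ℂ)` (the `ℚ`-structure of Hodge theory, Voisin I §7.1.1), a `ℚ`-submodule.

## Why ONE abelian variety, ONE tensor power and ONE twist suffice (equivalence with `ℳ(Ab)`)

The Tannakian category of polarisable `ℚ`-Hodge structures generated by the `H¹(Aᵢ)` is obtained by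
`⊕`, `⊗`, duals and subquotients. Duals: `H¹(A)^∨ ≅ H¹(A)(1)` by a polarisation; subquotients of
polarisable structures are direct summands (semisimplicity); `⊕ᵢ H¹(Aᵢ)^{⊗ mᵢ}(cᵢ)`: a PURE summand of
weight `w` only meets the indices with `mᵢ - 2cᵢ = w` (a morphism between pure structures of different
weights vanishes), and two such indices `(m, c)`, `(m + 2d, c + d)` are absorbed into the second over
`A × E` (`E` an elliptic curve): `H¹(A × E) = H¹(A) ⊕ H¹(E)` and `ℚ(-1) = Λ² H¹(E)` is a summand of
`H¹(E)^{⊗ 2}`, so `H¹(A)^{⊗ m}(c) = H¹(A)^{⊗ m} ⊗ ℚ(-d)(c + d)` is a summand of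
`H¹(A × E)^{⊗ (m+2d)}(c + d)`; several `Aᵢ` are absorbed into `∏ Aᵢ`. Hence for pure structures the
single-triple definition below is the classical notion. On the `ℚ`-LATTICE (not after `⊗ ℂ`: over `ℂ`
every Hodge structure is a sum of one-dimensional ones and the notion would be vacuous).

## What is proved (non-vacuity and closure of the single-triple predicate)

* `HodgeStructure.isOfAbelianType_hOne` — `H¹(A(ℂ); ℚ)` is of abelian type (`m = 1`, `c = 0`;
  rank-one comparison `H ≅ H^{⊗1}`, `map_F_le_tensorPowerFiltration_one` /
  `map_tensorPowerFiltration_one_le_F`).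
* `HodgeStructure.isOfAbelianType_abelianTensor` — every generator `(H¹(A)^{⊗ m})(c)` is.
* `HodgeStructure.IsOfAbelianType.of_retract` / `.cast` — retracts (isomorphic copies, direct
  summands) and weight transports of structures of abelian type are of abelian type.
* `HodgeStructure.IsOfAbelianType.tateTwist` / `IsAbelianTypeSummand.tateTwist` — Tate twists
  `H ↦ H(d)` preserve abelian type (`c ↦ c + d`; `Hom.tateTwist`, Hodge II 2.1.14).
* `HodgeStructure.tensorPowerFiltration_zero` — `F(H^{⊗0})` is the one-step filtration at `0`
  (`H^{⊗0} = ℚ(0)`), whence `isOfAbelianType_tate_of` / `isOfAbelianType_tate` — the Tate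
  structures `ℚ(c)` are of abelian type (`m = 0`; André §6.1: `ℳ(𝒜b)` "contient les objets de
  Tate"), the latter hypothesis-free through the tree's existence theorems for complex abelian
  varieties and their Hodge models.
-/

noncomputable section

open scoped TensorProduct
open Literature.AlgebraicTopology.SingularHomology

universe u

namespace Literature.AlgebraicGeometry.Motives

/-! ### Rational points of a complex subspace of `Hᵏ(Y; ℂ)` -/

section RatPoints

variable {Y : Type u} [TopologicalSpace Y] {k : ℕ}

/-- **The rational points `N_ℚ := {a ∈ Hᵏ(Y; ℚ) | a ⊗ 1 ∈ S}` of a complex subspace `S ≤ Hᵏ(Y; ℂ)`**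
(the `ℚ`-structure `Hᵏ(Y; ℚ) ⊗ ℂ = Hᵏ(Y; ℂ)` of Hodge theory: Voisin I §7.1.1, "`V_ℚ ⊂ V_ℂ`"; the
lattice map is the tree's `HodgeTheory.ofRatClass`, `ℚ`-homogeneous by `Motives.ofRatClass_smul`).
A `ℚ`-submodule of `Hᵏ(Y; ℚ)`. [cite: VoisinHodgeI2002, §7.1.1] -/
def ratPoints (S : Submodule ℂ (singularCohomology ℂ ℂ Y k)) :
    Submodule ℚ (singularCohomology ℚ ℚ Y k) where
  carrier := {a | HodgeTheory.ofRatClass Y k a ∈ S}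
  add_mem' {a b} ha hb := by
    simp only [Set.mem_setOf_eq, map_add] at ha hb ⊢
    exact S.add_mem ha hb
  zero_mem' := by simp only [Set.mem_setOf_eq, map_zero]; exact S.zero_mem
  smul_mem' q a ha := by
    simp only [Set.mem_setOf_eq] at ha ⊢
    rw [ofRatClass_smul]
    exact S.smul_mem _ ha

/-- Unfolding: `a ∈ ratPoints S ↔ a ⊗ 1 ∈ S`. [cite: VoisinHodgeI2002, §7.1.1] -/
@[simp]
theorem mem_ratPoints_iff (S : Submodule ℂ (singularCohomology ℂ ℂ Y k))
    (a : singularCohomology ℚ ℚ Y k) : a ∈ ratPoints S ↔ HodgeTheory.ofRatClass Y k a ∈ S :=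
  Iff.rfl

/-- `ratPoints` is monotone. [folklore] -/
theorem ratPoints_mono {S T : Submodule ℂ (singularCohomology ℂ ℂ Y k)} (h : S ≤ T) :
    ratPoints S ≤ ratPoints T := fun _ ha ↦ h ha

/-- The rational points of the whole space are the whole lattice. [folklore] -/
@[simp]
theorem ratPoints_top : ratPoints (⊤ : Submodule ℂ (singularCohomology ℂ ℂ Y k)) = ⊤ :=
  eq_top_iff.2 fun _ _ ↦ Submodule.mem_top

end RatPoints

namespace HodgeStructure

variable {V : Type u} [AddCommGroup V] [Module ℚ V] {w : ℤ}

/-! ### The abelian tensor targets `(H¹(A(ℂ); ℚ)^{⊗ m})(c)` -/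

/-- **The `ℚ`-Hodge structure `(H¹(A(ℂ); ℚ)^{⊗ m})(c)`**, of weight `m - 2c`, attached to a complex
abelian variety `A` (smooth projective of dimension `A.dim`, witness `hA` — always available as
`Motives.AbelianVariety.isSmoothProjective_holds`) and a Hodge symmetric Hodge model `M` of `A`: the
weight-one structure `M.hodgeStructure hA hM 1` on `H¹(A(ℂ); ℚ)` (Voisin I §7.1.1 Def. 7.4), its
`m`-th tensor power (Deligne, Hodge II 1.1.12) and the Tate twist by `c` (Hodge II 2.1.13), with the
filtration facts of the tree's theorem `hodgeTensorFacts_holds`. These are the generators of André's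
`ℳ(𝒜b)` on the Hodge side ("engendrée par les `h(A)` …; elle contient les objets de Tate", §6.1).
[cite: Andre1996Motifs, §6.1 (p. 30)] [cite: DeligneHodgeII1971, 1.1.12 and 2.1.13]
[cite: VoisinHodgeI2002, §7.1.1 Def. 7.4] -/
def abelianTensor (A : AbelianVariety ℂ) (hA : IsSmoothProjective A.dim A.X)
    (M : HodgeTheory.HodgeModel A.dim A.X) (hM : M.IsHodgeSymmetric) (m : ℕ) (c : ℤ) :
    HodgeStructure (⨂[ℚ]^m (singularCohomology ℚ ℚ (ComplexPoints A.X) 1)) ((m : ℤ) - 2 * c) :=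
  haveI := hodgeTensorFacts_holds.{0, 0}
  (((M.hodgeStructure hA hM 1).tensorPower m).tateTwist c).cast (by push_cast; ring)

/-- The filtration of `abelianTensor`: `Fᵖ((H¹)^{⊗ m}(c)) = Fᵖ⁺ᶜ((H¹)^{⊗ m})`, the tensor-power
filtration of the weight-one structure of `A` shifted by the twist. [cite: DeligneHodgeII1971, 2.1.13] -/
theorem abelianTensor_F (A : AbelianVariety ℂ) (hA : IsSmoothProjective A.dim A.X)
    (M : HodgeTheory.HodgeModel A.dim A.X) (hM : M.IsHodgeSymmetric) (m : ℕ) (c : ℤ) (p : ℤ) :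
    (abelianTensor A hA M hM m c).F p = (M.hodgeStructure hA hM 1).tensorPowerFiltration m (p + c) :=
  rfl

/-! ### Hodge structures, and summands, of abelian type -/

/-- **`H` is a `ℚ`-Hodge structure OF ABELIAN TYPE**: it is a direct summand, in the category of
`ℚ`-Hodge structures, of `(H¹(A(ℂ); ℚ)^{⊗ m})(c)` for some complex abelian variety `A` (with Hodge
symmetric model `M`), `m : ℕ` and `c : ℤ` with `m - 2c = w` — morphisms of Hodge structures
`j : H → T`, `r : T → H` (`HodgeStructure.Hom`: `ℚ`-linear, complexification filtered) with
`r ∘ j = id`. For pure structures this is membership in the Tannakian category generated by the `H¹`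
of abelian varieties, André's `ℳ(𝒜b)` on the Hodge side (module docstring: several `(Aᵢ, mᵢ, cᵢ)`
are absorbed into one). Stated on the `ℚ`-lattice: after `⊗ ℂ` the notion would be empty of content.
[cite: Andre1996Motifs, §6.1 (p. 30) and Thm. 0.6.3 (p. 9)] [cite: Moonen2017FamiliesMotives, §3] -/
def IsOfAbelianType (H : HodgeStructure V w) : Prop :=
  ∃ (A : AbelianVariety ℂ) (hA : IsSmoothProjective A.dim A.X) (M : HodgeTheory.HodgeModel A.dim A.X)
    (hM : M.IsHodgeSymmetric) (m : ℕ) (c : ℤ) (hw : (m : ℤ) - 2 * c = w)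
    (j : H.Hom ((abelianTensor A hA M hM m c).cast hw))
    (r : ((abelianTensor A hA M hM m c).cast hw).Hom H),
    ∀ v, r.toLinearMap (j.toLinearMap v) = v

/-- **The `ℚ`-subspace `N ≤ V` is an ABELIAN-TYPE SUMMAND through `H`**: for some complex abelian
variety `A` (Hodge symmetric model `M`), `m`, `c` with `m - 2c = w`, there are morphisms of Hodge
structures `j : H → (H¹(A)^{⊗ m})(c)` and `r : (H¹(A)^{⊗ m})(c) → H` with `r (j v) = v` for every
`v ∈ N` and `range r ≤ N`. Then `N = range r` (`IsAbelianTypeSummand.eq_range`), so `N` underlies a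
sub-Hodge structure of `H` which is a direct summand of `(H¹(A)^{⊗ m})(c)`, i.e. of abelian type; for
`H` polarisable (semisimple) this is equivalent to "`N` is a sub-Hodge structure of abelian type".
The predicate through which a route may speak of the Hodge type of a PIECE `N ⊆ Hᵏ(X(ℂ); ℚ)` without
first proving that the piece is a sub-Hodge structure. [cite: Andre1996Motifs, §6.1 (p. 30) and §6.3 (p. 31)]
[cite: Moonen2017FamiliesMotives, §3] -/
def IsAbelianTypeSummand (H : HodgeStructure V w) (N : Submodule ℚ V) : Prop :=
  ∃ (A : AbelianVariety ℂ) (hA : IsSmoothProjective A.dim A.X) (M : HodgeTheory.HodgeModel A.dim A.X)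
    (hM : M.IsHodgeSymmetric) (m : ℕ) (c : ℤ) (hw : (m : ℤ) - 2 * c = w)
    (j : H.Hom ((abelianTensor A hA M hM m c).cast hw))
    (r : ((abelianTensor A hA M hM m c).cast hw).Hom H),
    (∀ v ∈ N, r.toLinearMap (j.toLinearMap v) = v) ∧ LinearMap.range r.toLinearMap ≤ N

/-- `⊤` is an abelian-type summand through `H` iff `H` is of abelian type. [folklore] -/
theorem isAbelianTypeSummand_top_iff (H : HodgeStructure V w) :
    H.IsAbelianTypeSummand ⊤ ↔ H.IsOfAbelianType := by
  constructor
  · rintro ⟨A, hA, M, hM, m, c, hw, j, r, hjr, -⟩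
    exact ⟨A, hA, M, hM, m, c, hw, j, r, fun v ↦ hjr v Submodule.mem_top⟩
  · rintro ⟨A, hA, M, hM, m, c, hw, j, r, hjr⟩
    exact ⟨A, hA, M, hM, m, c, hw, j, r, fun v _ ↦ hjr v, le_top⟩

/-- An abelian-type summand `N` is the range of the retraction `r`: in the notation of the definition,
`N = range r`. [folklore] -/
theorem IsAbelianTypeSummand.eq_range {H : HodgeStructure V w} {N : Submodule ℚ V}
    {W : Type} [AddCommGroup W] [Module ℚ W] {T : HodgeStructure W w} (j : H.Hom T) (r : T.Hom H)
    (hjr : ∀ v ∈ N, r.toLinearMap (j.toLinearMap v) = v) (hr : LinearMap.range r.toLinearMap ≤ N) :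
    N = LinearMap.range r.toLinearMap :=
  le_antisymm (fun v hv ↦ ⟨j.toLinearMap v, hjr v hv⟩) hr

/-- Abelian-type summands are transported along morphisms of Hodge structures with a left inverse:
if `e : H → H'` has a retraction `e' : H' → H` (`e' ∘ e = id`), the image under `e` of an abelian-type
summand through `H` is an abelian-type summand through `H'` (compose `j` with `e'` and `r` with `e`).
[folklore] -/
theorem IsAbelianTypeSummand.map {H : HodgeStructure V w} {N : Submodule ℚ V}
    {V' : Type u} [AddCommGroup V'] [Module ℚ V'] {H' : HodgeStructure V' w}
    (e : H.Hom H') (e' : H'.Hom H) (he : ∀ v, e'.toLinearMap (e.toLinearMap v) = v)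
    (h : H.IsAbelianTypeSummand N) :
    H'.IsAbelianTypeSummand (N.map e.toLinearMap) := by
  obtain ⟨A, hA, M, hM, m, c, hw, j, r, hjr, hr⟩ := h
  refine ⟨A, hA, M, hM, m, c, hw, j.comp e', e.comp r, ?_, ?_⟩
  · rintro _ ⟨v, hv, rfl⟩
    show e.toLinearMap (r.toLinearMap (j.toLinearMap (e'.toLinearMap (e.toLinearMap v)))) =
      e.toLinearMap v
    rw [he v, hjr v hv]
  · rintro _ ⟨t, rfl⟩
    exact ⟨r.toLinearMap t, hr ⟨t, rfl⟩, rfl⟩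

/-! ### Rank one: `V ≅ V^{⊗1}` is an isomorphism of Hodge structures `H ≅ H^{⊗1}`

The filtration of the first tensor power `H^{⊗1}` (`HodgeStructure.tensorPowerFiltration H 1`,
Deligne, Hodge II, 1.1.12 with the single multi-index `(p)`) corresponds to the filtration of `H`
under `v ↦ ⊗(v)` and `⊗(f) ↦ f 0` (Mathlib's `PiTensorProduct.subsingletonEquiv`). This is the
computation behind the non-vacuity instance `isOfAbelianType_hOne` below (`m = 1`, `c = 0`). -/

section RankOne

variable {n : ℤ}

/-- The comparison map `piTensorBaseChange` after the complexification of any `ℚ`-linear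
`j : V → V^{⊗1}` with `j v = ⊗(v)` is `y ↦ ⊗(y)` on `V_ℂ`. Private: base-change plumbing for
Mathlib's `PiTensorProduct.subsingletonEquiv`. [folklore] -/
private theorem piTensorBaseChange_baseChange_of_eq_tprod (j : V →ₗ[ℚ] ⨂[ℚ]^1 V)
    (hj : ∀ v, j v = PiTensorProduct.tprod ℚ fun _ : Fin 1 => v) (y : ℂ ⊗[ℚ] V) :
    piTensorBaseChange V (Fin 1) (j.baseChange ℂ y) =
      PiTensorProduct.tprod ℂ fun _ : Fin 1 => y := by
  induction y using TensorProduct.induction_on with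
  | zero =>
    rw [map_zero, map_zero,
      ← PiTensorProduct.subsingletonEquiv_symm_apply' (R := ℂ) (0 : Fin 1) (0 : ℂ ⊗[ℚ] V), map_zero]
  | tmul c v =>
    rw [LinearMap.baseChange_tmul, hj, piTensorBaseChange_tmul_tprod,
      ← PiTensorProduct.subsingletonEquiv_symm_apply' (R := ℂ) (0 : Fin 1) (ofRat v), ← map_smul,
      ← PiTensorProduct.subsingletonEquiv_symm_apply' (R := ℂ) (0 : Fin 1) (c ⊗ₜ[ℚ] v), ofRat_apply,
      TensorProduct.smul_tmul', smul_eq_mul, mul_one]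
  | add x y hx hy =>
    rw [map_add, map_add, hx, hy,
      ← PiTensorProduct.subsingletonEquiv_symm_apply' (R := ℂ) (0 : Fin 1) x,
      ← PiTensorProduct.subsingletonEquiv_symm_apply' (R := ℂ) (0 : Fin 1) y, ← map_add,
      PiTensorProduct.subsingletonEquiv_symm_apply']

/-- The complexification of any `ℚ`-linear `r : V^{⊗1} → V` with `r (⊗ f) = f 0` is, after the
comparison map `piTensorBaseChange`, the rank-one contraction `⊗(y) ↦ y` on `(V_ℂ)^{⊗1}`
(Mathlib's `PiTensorProduct.subsingletonEquiv` over `ℂ`). Private: base-change plumbing. [folklore] -/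
private theorem baseChange_eq_subsingletonEquiv_piTensorBaseChange (r : (⨂[ℚ]^1 V) →ₗ[ℚ] V)
    (hr : ∀ f : Fin 1 → V, r (PiTensorProduct.tprod ℚ f) = f 0) (X : ℂ ⊗[ℚ] ⨂[ℚ]^1 V) :
    r.baseChange ℂ X =
      PiTensorProduct.subsingletonEquiv (R := ℂ) (s := fun _ : Fin 1 => ℂ ⊗[ℚ] V) (0 : Fin 1)
        (piTensorBaseChange V (Fin 1) X) := by
  induction X using TensorProduct.induction_on with
  | zero => rw [map_zero, map_zero, map_zero]
  | tmul c t =>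
    induction t using PiTensorProduct.induction_on with
    | smul_tprod q f =>
      rw [← TensorProduct.smul_tmul, LinearMap.baseChange_tmul, hr, piTensorBaseChange_tmul_tprod,
        map_smul, PiTensorProduct.subsingletonEquiv_apply_tprod, ofRat_apply,
        TensorProduct.smul_tmul', smul_eq_mul, mul_one]
    | add x y hx hy => rw [TensorProduct.tmul_add, map_add, map_add, map_add, hx, hy]
  | add x y hx hy => rw [map_add, map_add, map_add, hx, hy]

/-- **Rank one, `H → H^{⊗1}`:** the complexification of `v ↦ ⊗(v)` maps `Fᵖ V_ℂ` into
`Fᵖ(V^{⊗1})` (the tree's `tensorPowerFiltration`, Deligne, Hodge II, 1.1.12, multi-index `(p)`).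
[cite: DeligneHodgeII1971, 1.1.12] -/
theorem map_F_le_tensorPowerFiltration_one (H : HodgeStructure V n) (p : ℤ)
    (j : V →ₗ[ℚ] ⨂[ℚ]^1 V) (hj : ∀ v, j v = PiTensorProduct.tprod ℚ fun _ : Fin 1 => v) :
    (H.F p).map (j.baseChange ℂ) ≤ H.tensorPowerFiltration 1 p := by
  rintro _ ⟨y, hy, rfl⟩
  refine Submodule.mem_iSup_of_mem (fun _ => p) (Submodule.mem_iSup_of_mem (by simp) ?_)
  rw [Submodule.mem_comap, piTensorBaseChange_baseChange_of_eq_tprod j hj y]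
  exact ⟨PiTensorProduct.tprod ℂ fun _ => (⟨y, hy⟩ : H.F p), by simp⟩

/-- **Rank one, `H^{⊗1} → H`:** the complexification of `⊗(f) ↦ f 0` maps `Fᵖ(V^{⊗1})` into
`Fᵖ V_ℂ`: on the multi-index `(a₀)` with `p ≤ a₀`, `⊗(y) ↦ y ∈ F^{a₀} ⊆ Fᵖ`
(Deligne, Hodge II, 1.1.12). [cite: DeligneHodgeII1971, 1.1.12] -/
theorem map_tensorPowerFiltration_one_le_F (H : HodgeStructure V n) (p : ℤ)
    (r : (⨂[ℚ]^1 V) →ₗ[ℚ] V) (hr : ∀ f : Fin 1 → V, r (PiTensorProduct.tprod ℚ f) = f 0) :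
    (H.tensorPowerFiltration 1 p).map (r.baseChange ℂ) ≤ H.F p := by
  rw [Submodule.map_le_iff_le_comap]
  refine iSup_le fun a => iSup_le fun ha => ?_
  rintro X ⟨Y, hY⟩
  have hp : p ≤ a 0 := by simpa using ha
  rw [Submodule.mem_comap, baseChange_eq_subsingletonEquiv_piTensorBaseChange r hr X, ← hY]
  refine H.antitone_F hp ?_
  clear hY
  induction Y using PiTensorProduct.induction_on with
  | smul_tprod q f =>
    rw [map_smul, PiTensorProduct.mapIncl, PiTensorProduct.map_tprod, map_smul,
      PiTensorProduct.subsingletonEquiv_apply_tprod]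
    exact Submodule.smul_mem _ q (f 0).2
  | add x y hx hy =>
    rw [map_add, map_add]
    exact Submodule.add_mem _ hx hy

end RankOne

/-! ### Non-vacuity: `H¹(A)` is of abelian type -/

/-- **`H¹(A(ℂ); ℚ)` is of abelian type** (validation instance V-B14 of the lane's Layer-B
tribunal: the predicate `IsOfAbelianType` is inhabited). In the notation of `IsOfAbelianType`:
`m = 1`, `c = 0`, and `j : H¹(A) → (H¹(A)^{⊗1})(0)`, `r : (H¹(A)^{⊗1})(0) → H¹(A)` are the two
directions of `V ≅ V^{⊗1}` (Mathlib's `PiTensorProduct.subsingletonEquiv`), morphisms of Hodge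
structures by `map_F_le_tensorPowerFiltration_one` / `map_tensorPowerFiltration_one_le_F`, with
`r ∘ j = id`. André, §6.1: `ℳ(𝒜b)` is "engendrée par les `h(A)`" — in particular each `h¹(A)`
lies in it. [cite: Andre1996Motifs, §6.1 (p. 30)] [cite: DeligneHodgeII1971, 1.1.12] -/
theorem isOfAbelianType_hOne (A : AbelianVariety ℂ) (hA : IsSmoothProjective A.dim A.X)
    (M : HodgeTheory.HodgeModel A.dim A.X) (hM : M.IsHodgeSymmetric) :
    (M.hodgeStructure hA hM 1).IsOfAbelianType := by
  refine ⟨A, hA, M, hM, 1, 0, by norm_num,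
    ⟨((PiTensorProduct.subsingletonEquiv (R := ℚ)
        (s := fun _ : Fin 1 => singularCohomology ℚ ℚ (ComplexPoints A.X) 1) (0 : Fin 1)).symm :
        _ →ₗ[ℚ] _), fun p => ?_⟩,
    ⟨(PiTensorProduct.subsingletonEquiv (R := ℚ)
        (s := fun _ : Fin 1 => singularCohomology ℚ ℚ (ComplexPoints A.X) 1) (0 : Fin 1) :
        _ →ₗ[ℚ] _), fun p => ?_⟩,
    fun v => LinearEquiv.apply_symm_apply _ v⟩
  · rw [cast_F, abelianTensor_F, add_zero]
    exact map_F_le_tensorPowerFiltration_one _ p _ fun v =>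
      PiTensorProduct.subsingletonEquiv_symm_apply' (0 : Fin 1) v
  · rw [cast_F, abelianTensor_F, add_zero]
    exact map_tensorPowerFiltration_one_le_F _ p _ fun f =>
      PiTensorProduct.subsingletonEquiv_apply_tprod (0 : Fin 1) f

/-! ### Closure: every generator, retracts, Tate twists

André, §6.1 (p. 30): `ℳ(𝒜b)_𝒱` is "la sous-catégorie tannakienne […] engendrée par les `𝔥(A)` et
les motifs d'Artin; elle contient les objets de Tate". A Tannakian subcategory is stable under
direct factors and under `⊗` by its objects, in particular by the Tate objects `ℚ(d)` — on the Hodge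
side, under Tate twists `H ↦ H(d)` (Deligne, Hodge II, 2.1.13–2.1.14: `H(d) = H ⊗ ℚ(d)`, same
`ℚ`-space, `Fᵖ H(d) = Fᵖ⁺ᵈ H`). The theorems of this section are these stabilities for the
single-triple predicate `IsOfAbelianType` (module docstring): every generator
`(H¹(A)^{⊗ m})(c)` is of abelian type; a retract (in particular an isomorphic copy, a direct
summand) of a structure of abelian type is of abelian type; `H(d)` is of abelian type when `H` is
(`c ↦ c + d`); and summands `IsAbelianTypeSummand H N` twist likewise. -/

section Closure

universe v

variable {n : ℤ}

/-- **The Tate twist of a morphism of Hodge structures** `f : H₁ → H₂` is the same `ℚ`-linear map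
`f(d) : H₁(d) → H₂(d)` (`Fᵖ Hᵢ(d) = Fᵖ⁺ᵈ Hᵢ`, so the filtration condition at `p` is that of `f`
at `p + d`): `- ⊗ ℚ(d)` is a functor (Deligne, Hodge II, 2.1.14). [cite: DeligneHodgeII1971, 2.1.13–2.1.14] -/
def Hom.tateTwist {W : Type v} [AddCommGroup W] [Module ℚ W] {H₁ : HodgeStructure V n}
    {H₂ : HodgeStructure W n} (f : H₁.Hom H₂) (d : ℤ) :
    (H₁.tateTwist d).Hom (H₂.tateTwist d) where
  toLinearMap := f.toLinearMap
  map_F_le p := f.map_F_le (p + d)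

/-- The Tate twist `f(d) = f ⊗ ℚ(d)` of a morphism has the same underlying linear map
(`ℚ(d)` has underlying space `ℚ`). [cite: DeligneHodgeII1971, 2.1.13–2.1.14] -/
@[simp]
theorem Hom.tateTwist_toLinearMap {W : Type v} [AddCommGroup W] [Module ℚ W]
    {H₁ : HodgeStructure V n} {H₂ : HodgeStructure W n} (f : H₁.Hom H₂) (d : ℤ) :
    (f.tateTwist d).toLinearMap = f.toLinearMap :=
  rfl

/-- **The identity of `V` as a morphism `H → H'`** between two Hodge structures of the same weight
on the same space whose filtrations agree termwise (e.g. `H` and a transport `H.cast _`, or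
`(T(c))(d)` and `T(c + d)`). [folklore] -/
def Hom.ofEqF {H H' : HodgeStructure V n} (h : ∀ p, H.F p = H'.F p) : H.Hom H' where
  toLinearMap := LinearMap.id
  map_F_le p := by rw [LinearMap.baseChange_id, Submodule.map_id, h p]

/-- **Every generator `(H¹(A(ℂ); ℚ)^{⊗ m})(c)` is of abelian type**: in the notation of
`IsOfAbelianType`, the same `(A, M, m, c)`, `hw = rfl`, and `j = r = id` (`Hom.ofEqF` across the
trivial transport `cast rfl`). André, §6.1: `ℳ(𝒜b)` is generated by the `𝔥(A)` and contains the
Tate objects, so it contains every `𝔥¹(A)^{⊗ m}(c)`. [cite: Andre1996Motifs, §6.1 (p. 30)]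
[cite: DeligneHodgeII1971, 1.1.12 and 2.1.13] -/
theorem isOfAbelianType_abelianTensor (A : AbelianVariety ℂ) (hA : IsSmoothProjective A.dim A.X)
    (M : HodgeTheory.HodgeModel A.dim A.X) (hM : M.IsHodgeSymmetric) (m : ℕ) (c : ℤ) :
    (abelianTensor A hA M hM m c).IsOfAbelianType :=
  ⟨A, hA, M, hM, m, c, rfl, Hom.ofEqF fun p ↦ (cast_F _ rfl p).symm,
    Hom.ofEqF fun p ↦ cast_F _ rfl p, fun _ ↦ rfl⟩

/-- **Retracts of structures of abelian type are of abelian type**: if `e : H' → H` has a left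
inverse `e' : H → H'` in the category of `ℚ`-Hodge structures (`e' ∘ e = id`; e.g. `e` an
isomorphism, or `H'` a direct summand of `H`) and `H` is a direct summand of `(H¹(A)^{⊗ m})(c)`
through `(j, r)`, then `H'` is one through `(j ∘ e, e' ∘ r)`. This is the stability of André's
Tannakian subcategory `ℳ(𝒜b)` under direct factors, on the Hodge side.
[cite: Andre1996Motifs, §6.1 (p. 30)] -/
theorem IsOfAbelianType.of_retract {H : HodgeStructure V w} {V' : Type v} [AddCommGroup V']
    [Module ℚ V'] {H' : HodgeStructure V' w} (e : H'.Hom H) (e' : H.Hom H')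
    (he : ∀ v, e'.toLinearMap (e.toLinearMap v) = v) (h : H.IsOfAbelianType) :
    H'.IsOfAbelianType := by
  obtain ⟨A, hA, M, hM, m, c, hw, j, r, hjr⟩ := h
  refine ⟨A, hA, M, hM, m, c, hw, j.comp e, e'.comp r, fun v ↦ ?_⟩
  show e'.toLinearMap (r.toLinearMap (j.toLinearMap (e.toLinearMap v))) = v
  rw [hjr, he]

/-- Structures of abelian type are stable under transport of the weight (`HodgeStructure.cast`:
same space, same filtration — an isomorphic copy; the case `e = e' = id` of `of_retract`,
stability of `ℳ(𝒜b)` under isomorphism). [cite: Andre1996Motifs, §6.1 (p. 30)] -/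
theorem IsOfAbelianType.cast {H : HodgeStructure V w} (h : H.IsOfAbelianType) {w' : ℤ}
    (hw' : w = w') : (H.cast hw').IsOfAbelianType := by
  subst hw'
  exact h.of_retract (Hom.ofEqF fun p ↦ cast_F H rfl p) (Hom.ofEqF fun p ↦ (cast_F H rfl p).symm)
    fun _ ↦ rfl

/-- **Tate twists of structures of abelian type are of abelian type**: if `H` is a direct summand
of `(H¹(A)^{⊗ m})(c)` through `(j, r)`, then `H(d)` is a direct summand of `(H¹(A)^{⊗ m})(c + d)`
through the twisted morphisms `(j(d), r(d))` (same linear maps; `Fᵖ(T(c))(d) = Fᵖ⁺ᵈ⁺ᶜ T =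
Fᵖ T(c + d)`). On the Hodge side this is the stability of `ℳ(𝒜b)` under `⊗ ℚ(d)` ("elle
contient les objets de Tate"). [cite: Andre1996Motifs, §6.1 (p. 30)]
[cite: DeligneHodgeII1971, 2.1.13–2.1.14] -/
theorem IsOfAbelianType.tateTwist {H : HodgeStructure V w} (h : H.IsOfAbelianType) (d : ℤ) :
    (H.tateTwist d).IsOfAbelianType := by
  obtain ⟨A, hA, M, hM, m, c, hw, j, r, hjr⟩ := h
  refine ⟨A, hA, M, hM, m, c + d, by rw [← hw]; ring, ⟨j.toLinearMap, fun p ↦ ?_⟩,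
    ⟨r.toLinearMap, fun p ↦ ?_⟩, hjr⟩
  · have hj := j.map_F_le (p + d)
    rw [cast_F, abelianTensor_F] at hj
    rw [tateTwist_F, cast_F, abelianTensor_F, show p + (c + d) = p + d + c by ring]
    exact hj
  · have hr := r.map_F_le (p + d)
    rw [cast_F, abelianTensor_F] at hr
    rw [cast_F, abelianTensor_F, tateTwist_F, show p + (c + d) = p + d + c by ring]
    exact hr

/-- **Abelian-type summands twist**: if `N ≤ V` is an abelian-type summand through `H`, it is one
through `H(d)` (same `N`, same morphisms, `c ↦ c + d`). [cite: DeligneHodgeII1971, 2.1.13–2.1.14] -/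
theorem IsAbelianTypeSummand.tateTwist {H : HodgeStructure V w} {N : Submodule ℚ V}
    (h : H.IsAbelianTypeSummand N) (d : ℤ) : (H.tateTwist d).IsAbelianTypeSummand N := by
  obtain ⟨A, hA, M, hM, m, c, hw, j, r, hjr, hr⟩ := h
  refine ⟨A, hA, M, hM, m, c + d, by rw [← hw]; ring, ⟨j.toLinearMap, fun p ↦ ?_⟩,
    ⟨r.toLinearMap, fun p ↦ ?_⟩, hjr, hr⟩
  · have hj := j.map_F_le (p + d)
    rw [cast_F, abelianTensor_F] at hj
    rw [tateTwist_F, cast_F, abelianTensor_F, show p + (c + d) = p + d + c by ring]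
    exact hj
  · have hr' := r.map_F_le (p + d)
    rw [cast_F, abelianTensor_F] at hr'
    rw [cast_F, abelianTensor_F, tateTwist_F, show p + (c + d) = p + d + c by ring]
    exact hr'

end Closure

/-! ### Rank zero: `H^{⊗0} = ℚ(0)` and the Tate objects

The filtration of the zeroth tensor power `H^{⊗0}` (on `V^{⊗0} ≅ ℚ`, Mathlib's
`PiTensorProduct.isEmptyEquiv`) is the one-step filtration at `0` — the single, empty, multi-index
has `Σ aᵢ = 0` (Deligne, Hodge II, 1.1.12) — so `(H¹(A)^{⊗0})(c)` is the Tate structure `ℚ(c)`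
(Hodge II, 2.1.13: `ℚ(c)` is purely of type `(-c, -c)`), for every `A`. Hence André's "elle
contient les objets de Tate" holds for the single-triple predicate with `m = 0`. -/

section RankZero

variable {n : ℤ}

/-- For an empty index type the inclusion of `⊗ᵢ Sᵢ` into `⊗ᵢ X` is onto (both sides are the
scalars, spanned by the empty tensor). Private plumbing. [folklore] -/
private theorem range_mapIncl_eq_top_of_isEmpty {ι : Type*} [IsEmpty ι] {X : Type*}
    [AddCommGroup X] [Module ℂ X] (S : ι → Submodule ℂ X) :
    LinearMap.range (PiTensorProduct.mapIncl S) = ⊤ := by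
  rw [eq_top_iff, ← PiTensorProduct.span_tprod_eq_top, Submodule.span_le]
  rintro _ ⟨f, rfl⟩
  refine ⟨PiTensorProduct.tprod ℂ fun i ↦ isEmptyElim i, ?_⟩
  rw [PiTensorProduct.mapIncl, PiTensorProduct.map_tprod]
  exact congrArg _ (funext fun i ↦ isEmptyElim i)

/-- **Rank zero:** the filtration of `H^{⊗0}` is the one-step filtration at `0`: `Fᵖ(V^{⊗0}) = ⊤`
for `p ≤ 0` (the empty multi-index) and `⊥` for `0 < p` (no multi-index) — `H^{⊗0}` is the unit
structure `ℚ(0)` (Deligne, Hodge II, 1.1.12 and 2.1.13). [cite: DeligneHodgeII1971, 1.1.12 and 2.1.13] -/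
theorem tensorPowerFiltration_zero (H : HodgeStructure V n) (p : ℤ) :
    H.tensorPowerFiltration 0 p = pureFiltration (⨂[ℚ]^0 V) 0 p := by
  by_cases hp : p ≤ 0
  · rw [pureFiltration_of_le hp, eq_top_iff]
    rintro x -
    refine Submodule.mem_iSup_of_mem (fun _ ↦ 0) (Submodule.mem_iSup_of_mem (by simpa using hp) ?_)
    rw [Submodule.mem_comap, range_mapIncl_eq_top_of_isEmpty]
    trivial
  · rw [pureFiltration_of_lt (not_le.1 hp), eq_bot_iff]
    exact iSup_le fun a ↦ iSup_le fun ha ↦ absurd (by simpa using ha) hp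

/-- **The Tate structures `ℚ(c)` are of abelian type, through any abelian variety** — André, §6.1
(p. 30), verbatim: `ℳ(𝒜b)_𝒱` "engendrée par les `𝔥(A)` et les motifs d'Artin; elle contient les
objets de Tate". In the notation of `IsOfAbelianType`: `m = 0`, twist `c`, and
`j : ℚ(c) → (H¹(A)^{⊗0})(c)`, `r : (H¹(A)^{⊗0})(c) → ℚ(c)` the two directions of `ℚ ≅ V^{⊗0}`
(Mathlib's `PiTensorProduct.isEmptyEquiv`), morphisms because both filtrations are the one-step
filtration at `-c` (`tate_F`, `tensorPowerFiltration_zero`), with `r ∘ j = id`.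
[cite: Andre1996Motifs, §6.1 (p. 30)] [cite: DeligneHodgeII1971, 1.1.12 and 2.1.13] -/
theorem isOfAbelianType_tate_of (A : AbelianVariety ℂ) (hA : IsSmoothProjective A.dim A.X)
    (M : HodgeTheory.HodgeModel A.dim A.X) (hM : M.IsHodgeSymmetric) (c : ℤ) :
    (tate c).IsOfAbelianType := by
  refine ⟨A, hA, M, hM, 0, c, by push_cast; ring,
    ⟨((PiTensorProduct.isEmptyEquiv (R := ℚ)
        (s := fun _ : Fin 0 => singularCohomology ℚ ℚ (ComplexPoints A.X) 1) (Fin 0)).symm :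
        ℚ →ₗ[ℚ] _), fun p => ?_⟩,
    ⟨(PiTensorProduct.isEmptyEquiv (R := ℚ)
        (s := fun _ : Fin 0 => singularCohomology ℚ ℚ (ComplexPoints A.X) 1) (Fin 0) :
        _ →ₗ[ℚ] ℚ), fun p => ?_⟩,
    fun v => LinearEquiv.apply_symm_apply _ v⟩
  · rw [cast_F, abelianTensor_F, tensorPowerFiltration_zero, tate_F]
    by_cases hp : p ≤ -c
    · rw [pureFiltration_of_le (show p + c ≤ 0 by omega)]
      exact le_top
    · rw [pureFiltration_of_lt (show -c < p by omega), Submodule.map_bot]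
      exact bot_le
  · rw [cast_F, abelianTensor_F, tensorPowerFiltration_zero, tate_F]
    by_cases hp : p ≤ -c
    · rw [pureFiltration_of_le hp]
      exact le_top
    · rw [pureFiltration_of_lt (show (0 : ℤ) < p + c by omega), Submodule.map_bot]
      exact bot_le

/-- **The Tate structures `ℚ(c)` are of abelian type** (hypothesis-free form of
`isOfAbelianType_tate_of`): abelian varieties over `ℂ` exist (`exists_abelianVariety_dim_eq_one`,
an elliptic curve), are smooth projective (`AbelianVariety.isSmoothProjective_holds`) and carry a
Hodge symmetric Hodge model (`exists_isReal_hodgeModel_holds`). André, §6.1: `ℳ(𝒜b)` "contient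
les objets de Tate". [cite: Andre1996Motifs, §6.1 (p. 30)] [cite: DeligneHodgeII1971, 2.1.13] -/
theorem isOfAbelianType_tate (c : ℤ) : (tate c).IsOfAbelianType := by
  obtain ⟨A, -⟩ := exists_abelianVariety_dim_eq_one ℂ
  have hA : IsSmoothProjective A.dim A.X := AbelianVariety.isSmoothProjective_holds
  obtain ⟨M, hM⟩ := HodgeTheory.exists_isReal_hodgeModel_holds.exists_isHodgeSymmetric hA
  exact isOfAbelianType_tate_of A hA M hM c

end RankZero

end HodgeStructure

end Literature.AlgebraicGeometry.Motives

end
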